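import Summits.Ventures.HodgeRepro2.T5KernelIdentityPointwise
import Summits.Ventures.HodgeRepro2.T5QuotientDecomposition
import Mathlib.MeasureTheory.Function.ContinuousMapDense
import Mathlib.Topology.Metrizable.Urysohn

/-!
# T5KernelIdentity — `η(f) = integralOp` on `L²(G ⧸ Γ, μ_𝓕)`, and [DE] Theorem 9.2.2 for the
quotient by a discrete cocompact subgroup, UNCONDITIONALLY

Cell pub-hodge-repro2, seat p5, Tier 5 (route/T5-N4-p5.md, N4.3 v13 (B1)–(B2)).  Row 57 reduced
[DE] Theorem 9.2.2 for `L²(G ⧸ Γ, ν)` to the single identity `KernelIdentity μ ν`; row 58 proved its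
pointwise form for `ν = μ_𝓕`, the quotient measure of a fundamental domain.  This file closes the
gap:

* `integrable_mul_bcf_smul`, `integrable_uncurry_inner`: the integrability needed for Fubini on
  `G × G ⧸ Γ` (`f ∈ L¹(μ)`, `w ∈ L²(ν)`, `vb` bounded continuous);
* `inner_etaOp_toLp`: for ANY finite `G`-invariant `ν` satisfying the pointwise identity of row 58,
  a bounded continuous `vb` and every `w ∈ L²(ν)`:
  `⟪w, η(f) (toLp vb)⟫ = ⟪w, integralOp ν (kernelCont …) (toLp vb)⟫` — Mathlib's
  `integral_inner`, Fubini (`integral_integral_swap`), the pointwise identity at every point of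
  the quotient;
* `etaOp_toLp_eq`, `etaOpL_eq_integralOp_of_pointwise`: hence the operator identity on all of
  `L²(ν)` (`ext_inner_left`; density of the bounded continuous functions,
  `BoundedContinuousFunction.toLp_denseRange`; `ContinuousLinearMap.ext_on`);
* `kernelIdentity`: **`KernelIdentity μ μ_𝓕` holds** (row 58 supplies the pointwise identity);
* `exists_decomposition_regularRep_quotient` (and `_of_discrete` for a discrete `Γ` of a Hausdorff
  `G`): **[DE] Theorem 9.2.2 for `L²(G ⧸ Γ, μ_𝓕)`** — the
  closed orthogonal sum of irreducible closed `G`-stable subspaces with every unitary-equivalence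
  class FINITE, with no hypothesis left beyond the standing ones (a unimodular Haar `μ` on a second
  countable `G`, a fundamental domain `𝓕` of a countable `Γ` with `Γ.op` properly discontinuous, a
  compact Hausdorff quotient, and the finiteness and `G`-invariance of `μ_𝓕` — the latter is
  Mathlib's `QuotientMeasureEqMeasurePreimage.smulInvariantMeasure_quotient` under its Polish-space
  hypotheses).

Mathlib only besides rows 36, 53, 56–58.  Axioms: propext, Classical.choice, Quot.sound.
README §8(d): uses an L-value-free non-vanishing device: NO.
-/

namespace Summit.Ventures.HodgeRepro2.T5KernelIdentity

open MeasureTheory Filter Topology BoundedContinuousFunction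
open scoped InnerProductSpace
open Summit.Ventures.HodgeRepro2.T5ConvolutionNatural
open Summit.Ventures.HodgeRepro2.T5ConvolutionAdjoint
open Summit.Ventures.HodgeRepro2.T5KernelOperatorCompact
open Summit.Ventures.HodgeRepro2.T5AutomorphizeKernel
open Summit.Ventures.HodgeRepro2.T5RegularRep
open Summit.Ventures.HodgeRepro2.T5KernelIdentityPointwise
open Summit.Ventures.HodgeRepro2.T5QuotientDecomposition
open Summit.Ventures.HodgeRepro2.T5FiniteMultiplicity (IsUnitaryEquiv)
open Summit.Ventures.HodgeRepro2.T5CompactDiscreteDecomposition (IrreducibleOn)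

variable {G : Type*} [Group G] [TopologicalSpace G] [IsTopologicalGroup G] [MeasurableSpace G]
  [BorelSpace G] (μ : Measure G) {Γ : Subgroup G}

attribute [-instance] Quotient.instMeasurableSpace

variable [MeasurableSpace (G ⧸ Γ)] [BorelSpace (G ⧸ Γ)]

/-! ### Integrability for Fubini -/

omit [MeasurableSpace (G ⧸ Γ)] [BorelSpace (G ⧸ Γ)] in
/-- `g ↦ f g * vb (g⁻¹ • x)` is integrable for `f ∈ L¹(μ)` and a bounded continuous `vb`. -/
theorem integrable_mul_bcf_smul {f : G → ℂ} (hf : Integrable f μ) (vb : (G ⧸ Γ) →ᵇ ℂ)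
    (x : G ⧸ Γ) : Integrable (fun g => f g * vb (g⁻¹ • x)) μ := by
  refine Integrable.mono' (hf.norm.mul_const ‖vb‖)
    (hf.aestronglyMeasurable.mul
      (vb.continuous.comp (continuous_inv.smul continuous_const)).aestronglyMeasurable) ?_
  refine Eventually.of_forall fun g => ?_
  show ‖f g * vb (g⁻¹ • x)‖ ≤ ‖f g‖ * ‖vb‖
  rw [norm_mul]
  exact mul_le_mul_of_nonneg_left (vb.norm_coe_le_norm _) (norm_nonneg _)

/-- The Fubini integrand `(g, x) ↦ f g * ⟪w x, vb (g⁻¹ • x)⟫` is integrable on `μ × ν`. -/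
theorem integrable_uncurry_inner [SecondCountableTopology G] (ν : Measure (G ⧸ Γ))
    [IsFiniteMeasure ν] {f : G → ℂ} (hf : Integrable f μ) (vb : (G ⧸ Γ) →ᵇ ℂ) (w : Lp ℂ 2 ν) :
    Integrable (Function.uncurry fun g x => f g * ⟪w x, vb (g⁻¹ • x)⟫_ℂ) (μ.prod ν) := by
  have hw : Integrable (fun x => w x) ν := (Lp.memLp w).integrable one_le_two
  refine Integrable.mono' (hf.norm.mul_prod (hw.norm.mul_const ‖vb‖)) ?_ ?_
  · have h1 : AEStronglyMeasurable (fun z : G × (G ⧸ Γ) => f z.1) (μ.prod ν) :=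
      hf.aestronglyMeasurable.comp_quasiMeasurePreserving Measure.quasiMeasurePreserving_fst
    have h2 : AEStronglyMeasurable (fun z : G × (G ⧸ Γ) => (w z.2 : ℂ)) (μ.prod ν) :=
      hw.aestronglyMeasurable.comp_quasiMeasurePreserving Measure.quasiMeasurePreserving_snd
    have h3 : AEStronglyMeasurable (fun z : G × (G ⧸ Γ) => vb (z.1⁻¹ • z.2)) (μ.prod ν) :=
      (vb.continuous.comp (continuous_fst.inv.smul continuous_snd)).aestronglyMeasurable
    exact h1.mul (h2.inner h3)
  · refine Eventually.of_forall fun z => ?_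
    show ‖f z.1 * ⟪w z.2, vb (z.1⁻¹ • z.2)⟫_ℂ‖ ≤ ‖f z.1‖ * (‖w z.2‖ * ‖vb‖)
    rw [norm_mul]
    refine mul_le_mul_of_nonneg_left ((norm_inner_le_norm _ _).trans ?_) (norm_nonneg _)
    exact mul_le_mul_of_nonneg_left (vb.norm_coe_le_norm _) (norm_nonneg _)

/-! ### The inner-product identity on bounded continuous functions -/

variable [LocallyCompactSpace G] [SecondCountableTopology G] [T2Space (G ⧸ Γ)]
  [CompactSpace (G ⧸ Γ)] [SecondCountableTopology (G ⧸ Γ)]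

/-- **The inner-product identity**: for a finite `G`-invariant `ν` on `G ⧸ Γ` satisfying the
pointwise unfolding identity (row 58), `f ∈ C_c(G)`, a bounded continuous `vb` on `G ⧸ Γ` and every
`w ∈ L²(ν)`: `⟪w, η(f) (toLp vb)⟫ = ⟪w, integralOp ν (kernelCont …) (toLp vb)⟫`. -/
theorem inner_etaOp_toLp [μ.IsMulLeftInvariant] [μ.IsInvInvariant] [IsFiniteMeasureOnCompacts μ]
    [ProperlyDiscontinuousSMul Γ.op G] (ν : Measure (G ⧸ Γ)) [IsFiniteMeasure ν]
    [SMulInvariantMeasure G (G ⧸ Γ) ν] {f : G → ℂ} (hfc : Continuous f)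
    (hfs : HasCompactSupport f) (hf : Integrable f μ)
    (hpt : ∀ (vb : (G ⧸ Γ) →ᵇ ℂ) (x : G),
      ∫ g, f g * vb (g⁻¹ * x : G) ∂μ = ∫ y, kernelQuot Γ f (x : G ⧸ Γ) y * vb y ∂ν)
    (vb : (G ⧸ Γ) →ᵇ ℂ) (w : Lp ℂ 2 ν) :
    ⟪w, etaOp μ (regularRep (G := G) ν) f (toLp (E := ℂ) 2 ν ℂ vb)⟫_ℂ =
      ⟪w, integralOp ν (kernelCont hfc hfs) (toLp (E := ℂ) 2 ν ℂ vb)⟫_ℂ := by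
  set v : Lp ℂ 2 ν := toLp (E := ℂ) 2 ν ℂ vb with hv
  have hvb : (v : G ⧸ Γ → ℂ) =ᵐ[ν] vb := coeFn_toLp 2 ν ℂ vb
  have hint : Integrable (fun g => f g • regularRep (G := G) ν g v) μ :=
    integrable_smul_apply μ _ (star_regularRep (G := G) ν) hf v
      (aestronglyMeasurable_regularRep μ ν v)
  -- `⟪w, ρ g v⟫ = ∫ x, ⟪w x, vb (g⁻¹ • x)⟫`
  have hρ : ∀ g : G, ⟪w, regularRep (G := G) ν g v⟫_ℂ =
      ∫ x, ⟪w x, vb (g⁻¹ • x)⟫_ℂ ∂ν := fun g => by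
    rw [L2.inner_def]
    refine integral_congr_ae ?_
    have h1 : (regularRep (G := G) ν g v : G ⧸ Γ → ℂ) =ᵐ[ν]
        (v : G ⧸ Γ → ℂ) ∘ (fun x => g⁻¹ • x) := coeFn_regularRep_apply ν g v
    have h2 : ((v : G ⧸ Γ → ℂ) ∘ fun x => g⁻¹ • x) =ᵐ[ν] (vb ∘ fun x => g⁻¹ • x) :=
      (measurePreserving_smul g⁻¹ ν).quasiMeasurePreserving.ae_eq_comp hvb
    filter_upwards [h1, h2] with x hx1 hx2
    rw [hx1, hx2]
    rfl
  -- the left-hand side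
  have hL : ⟪w, etaOp μ (regularRep (G := G) ν) f v⟫_ℂ =
      ∫ g, ∫ x, f g * ⟪w x, vb (g⁻¹ • x)⟫_ℂ ∂ν ∂μ :=
    calc ⟪w, etaOp μ (regularRep (G := G) ν) f v⟫_ℂ
        = ∫ g, ⟪w, f g • regularRep (G := G) ν g v⟫_ℂ ∂μ :=
          (integral_inner (𝕜 := ℂ) hint w).symm
      _ = ∫ g, ∫ x, f g * ⟪w x, vb (g⁻¹ • x)⟫_ℂ ∂ν ∂μ := by
          congr 1
          funext g
          rw [inner_smul_right, hρ g, ← integral_const_mul]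
  -- the right-hand side
  have hR : ⟪w, integralOp ν (kernelCont hfc hfs) v⟫_ℂ =
      ∫ x, ⟪w x, ∫ y, kernelQuot Γ f x y * vb y ∂ν⟫_ℂ ∂ν := by
    rw [L2.inner_def]
    refine integral_congr_ae ?_
    filter_upwards [coeFn_integralOp ν (kernelCont hfc hfs) v] with x hx
    rw [hx]
    congr 1
    refine integral_congr_ae ?_
    filter_upwards [hvb] with y hy
    rw [hy]
    rfl
  rw [hL, hR, integral_integral_swap (integrable_uncurry_inner μ ν hf vb w)]
  congr 1
  funext x
  refine QuotientGroup.induction_on x fun x₀ => ?_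
  calc ∫ g, f g * ⟪w (x₀ : G ⧸ Γ), vb (g⁻¹ • (x₀ : G ⧸ Γ))⟫_ℂ ∂μ
      = ∫ g, ⟪w (x₀ : G ⧸ Γ), f g * vb (g⁻¹ • (x₀ : G ⧸ Γ))⟫_ℂ ∂μ := by
        congr 1
        funext g
        rw [show f g * vb (g⁻¹ • (x₀ : G ⧸ Γ)) = f g • vb (g⁻¹ • (x₀ : G ⧸ Γ)) from rfl,
          inner_smul_right]
    _ = ⟪w (x₀ : G ⧸ Γ), ∫ g, f g * vb (g⁻¹ • (x₀ : G ⧸ Γ)) ∂μ⟫_ℂ :=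
        integral_inner (integrable_mul_bcf_smul μ hf vb _) _
    _ = ⟪w (x₀ : G ⧸ Γ), ∫ y, kernelQuot Γ f (x₀ : G ⧸ Γ) y * vb y ∂ν⟫_ℂ := by
        rw [← hpt vb x₀]
        rfl

/-- `η(f) (toLp vb) = integralOp ν (kernelCont …) (toLp vb)` for a bounded continuous `vb`. -/
theorem etaOp_toLp_eq [μ.IsMulLeftInvariant] [μ.IsInvInvariant] [IsFiniteMeasureOnCompacts μ]
    [ProperlyDiscontinuousSMul Γ.op G] (ν : Measure (G ⧸ Γ)) [IsFiniteMeasure ν]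
    [SMulInvariantMeasure G (G ⧸ Γ) ν] {f : G → ℂ} (hfc : Continuous f)
    (hfs : HasCompactSupport f) (hf : Integrable f μ)
    (hpt : ∀ (vb : (G ⧸ Γ) →ᵇ ℂ) (x : G),
      ∫ g, f g * vb (g⁻¹ * x : G) ∂μ = ∫ y, kernelQuot Γ f (x : G ⧸ Γ) y * vb y ∂ν)
    (vb : (G ⧸ Γ) →ᵇ ℂ) :
    etaOp μ (regularRep (G := G) ν) f (toLp (E := ℂ) 2 ν ℂ vb) =
      integralOp ν (kernelCont hfc hfs) (toLp (E := ℂ) 2 ν ℂ vb) :=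
  ext_inner_left ℂ fun w => inner_etaOp_toLp μ ν hfc hfs hf hpt vb w

/-- **The operator identity** `η(f) = integralOp ν (kernelCont …)` on `L²(G ⧸ Γ, ν)` from the
pointwise identity: both sides are continuous linear maps agreeing on the dense subspace of bounded
continuous functions. -/
theorem etaOpL_eq_integralOp_of_pointwise
    [μ.IsMulLeftInvariant] [μ.IsInvInvariant] [IsFiniteMeasureOnCompacts μ]
    [ProperlyDiscontinuousSMul Γ.op G] (ν : Measure (G ⧸ Γ)) [IsFiniteMeasure ν]
    [SMulInvariantMeasure G (G ⧸ Γ) ν] {f : G → ℂ} (hfc : Continuous f)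
    (hfs : HasCompactSupport f) (hf : Integrable f μ)
    (hpt : ∀ (vb : (G ⧸ Γ) →ᵇ ℂ) (x : G),
      ∫ g, f g * vb (g⁻¹ * x : G) ∂μ = ∫ y, kernelQuot Γ f (x : G ⧸ Γ) y * vb y ∂ν) :
    etaOpL μ (regularRep (G := G) ν) (star_regularRep (G := G) ν) hf
        (aestronglyMeasurable_regularRep μ ν) =
      integralOp ν (kernelCont hfc hfs) := by
  refine ContinuousLinearMap.ext_on (s := Set.range (toLp (E := ℂ) 2 ν ℂ)) ?_ ?_
  · exact (BoundedContinuousFunction.toLp_denseRange ℂ ν ℂ (p := 2) (by simp)).mono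
      Submodule.subset_span
  · rintro _ ⟨vb, rfl⟩
    exact etaOp_toLp_eq μ ν hfc hfs hf hpt vb

/-! ### The quotient measure of a fundamental domain -/

variable {𝓕 : Set G}

/-- The quotient measure `μ_𝓕 = map mk (μ.restrict 𝓕)`. -/
local notation "μ_𝓕" => Measure.map (@QuotientGroup.mk G _ Γ) (μ.restrict 𝓕)

/-- **`KernelIdentity μ μ_𝓕` holds** (row 58's pointwise identity + the operator identity). -/
theorem kernelIdentity [μ.IsMulLeftInvariant]
    [μ.IsMulRightInvariant] [μ.IsInvInvariant] [IsFiniteMeasureOnCompacts μ] [Countable Γ]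
    [ProperlyDiscontinuousSMul Γ.op G] (h𝓕 : IsFundamentalDomain Γ.op 𝓕 μ)
    [IsFiniteMeasure μ_𝓕] [SMulInvariantMeasure G (G ⧸ Γ) μ_𝓕] : KernelIdentity μ μ_𝓕 :=
  fun _ hf hfc hfs _ => etaOpL_eq_integralOp_of_pointwise μ μ_𝓕 hfc hfs hf
    fun vb x => integral_eq_integral_kernelQuot_of_bounded (μ := μ) h𝓕 hfc hfs vb x

/-- **[DE] Theorem 9.2.2 for `L²(G ⧸ Γ, μ_𝓕)`**: for a unimodular Haar measure `μ` on a second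
countable locally compact group `G`, a countable subgroup `Γ` with `Γ.op` properly discontinuous, a
fundamental domain `𝓕`, a compact Hausdorff quotient and a finite `G`-invariant quotient measure
`μ_𝓕`: `L²(G ⧸ Γ, μ_𝓕)` is the closed orthogonal sum of irreducible closed `G`-stable subspaces,
every unitary-equivalence class of which is FINITE. -/
theorem exists_decomposition_regularRep_quotient
    [μ.IsMulLeftInvariant] [μ.IsMulRightInvariant] [μ.IsInvInvariant] [μ.IsOpenPosMeasure]
    [IsFiniteMeasureOnCompacts μ] [Countable Γ] [ProperlyDiscontinuousSMul Γ.op G]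
    (h𝓕 : IsFundamentalDomain Γ.op 𝓕 μ) [IsFiniteMeasure μ_𝓕]
    [SMulInvariantMeasure G (G ⧸ Γ) μ_𝓕] :
    ∃ S : Set (Submodule ℂ (Lp ℂ 2 μ_𝓕)),
      (∀ U ∈ S, IrreducibleOn (regularRep (G := G) μ_𝓕) U) ∧
      S.Pairwise (fun U V => U ⟂ V) ∧ (sSup S).topologicalClosure = ⊤ ∧
      ∀ U₀ ∈ S, {U ∈ S | IsUnitaryEquiv (regularRep (G := G) μ_𝓕) U₀ U}.Finite :=
  exists_decomposition_regularRep μ μ_𝓕 (kernelIdentity μ h𝓕)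

omit [T2Space (G ⧸ Γ)] [SecondCountableTopology (G ⧸ Γ)] in
/-- The same for a DISCRETE `Γ` of a Hausdorff `G`: the proper discontinuity (row 55) and the
Hausdorff quotient (row 57) are supplied. -/
theorem exists_decomposition_regularRep_quotient_of_discrete [T2Space G] [DiscreteTopology Γ]
    [μ.IsMulLeftInvariant] [μ.IsMulRightInvariant] [μ.IsInvInvariant] [μ.IsOpenPosMeasure]
    [IsFiniteMeasureOnCompacts μ] [Countable Γ] (h𝓕 : IsFundamentalDomain Γ.op 𝓕 μ)
    [IsFiniteMeasure μ_𝓕] [SMulInvariantMeasure G (G ⧸ Γ) μ_𝓕] :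
    ∃ S : Set (Submodule ℂ (Lp ℂ 2 μ_𝓕)),
      (∀ U ∈ S, IrreducibleOn (regularRep (G := G) μ_𝓕) U) ∧
      S.Pairwise (fun U V => U ⟂ V) ∧ (sSup S).topologicalClosure = ⊤ ∧
      ∀ U₀ ∈ S, {U ∈ S | IsUnitaryEquiv (regularRep (G := G) μ_𝓕) U₀ U}.Finite :=
  haveI := Summit.Ventures.HodgeRepro2.T5AutomorphizeContinuous.properlyDiscontinuousSMul_op Γ
  haveI : T2Space (G ⧸ Γ) := t2Space_quotient
  exists_decomposition_regularRep_quotient μ h𝓕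

end Summit.Ventures.HodgeRepro2.T5KernelIdentity
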